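import Summits.PneNP.PneNP.Theorems.ChebyshevTracialDesignJuntaTiltedProfile
import Summits.PneNP.PneNP.Theorems.ChebyshevTracialDesignJuntaRemainderRung
import Summits.PneNP.PneNP.Theorems.ChebyshevTracialDesignShellOperatorForm
import HarnessLib

/-!
# Cell pnp-psdrank, route `ChebyshevTracialDesign`: (CG_1') FOR JUNTA MASKS IN EVERY DIRECTION — per matching
# `Q^f_M(v) ≤ |PM|⁻¹·B_v·C(T,D+1)·‖v‖₁²Λ_f·4^{|J|+2}C(|J|+2,D+1)(D+1)!N^{|J|+1−D}/[N]_{|J|+2}` for ANY `v`, hence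
# `Σ_M sup_{v_M∈[−1,1]^n}(Q^f_M(v_M))₊ ≤ B_v·C(T,D+1)·n²Λ_f·8^{|J|+2}C(|J|+2,D+1)(D+1)!/N^{D+1}`: the (CG_1') defect of every nonnegative junta mask of size
# `O(dq n)` is super-polynomially small, with the sup over ALL (dense, sign-incoherent, matching-adapted) directions (crux `TracialDecayExp20`, stmt-PneNP-19878)

Brick 113b (prover g20; MEMO-23 §2(d)). Inside (CG_1') (MEMO-21 §3(c'), bricks 98–112) the priced cells were: the sign-coherent cone (102), the level
direction (103), low-degree SOS masks per matching (103/109, `|J|+2 ≤ D`), fixed directions on M-average (104/105), and juntas × SPARSE directions beyond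
the design degree (112). Brick 113a (`tiltedJunta_levelLaw`) removes the sparseness: the profile of `f·C_v²` has nonnegative virtual value (SOS, Grigoriev)
and is smooth (patterns, termwise — the signs of `v_pv_q` never enter a positivity argument), so the Newton remainder prices it in EVERY direction:
* §1 `sum_shell_eq_sum_crIn` (shell sums ↔ the crossing/internal-count filter), **`designValue_le_of_levelLaw`** — generic: an exact design prices a
  statistic whose level sums at `M` are `T(N;c,i)·P(c)` at `≤ |PM|⁻¹·(−P(0) + B_v·C(T,D+1)·max_{[0,N]}|P^{(D+1)}|)` (bricks 111 + lit `ExactDesignRemainder`).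
* §2 **`containment_junta_le_allDirections`** (per matching, any `v : Fin n → ℝ`; exact design, `2(|J|+2)+1 ≤ t`, `0 ≤ f ≤ Λ_f` a `J`-junta),
  **`sum_posPart_containment_junta_allDirections`** (cube directions chosen per matching; power form `8^{|J|+2}/N^{D+1}` via brick 110c
  `pow_div_descFactorial_le`), `…_bal` (balanced Chebyshev instance: `≈ 20Λ_f n²·8^{|J|+2}(8(|J|+2)/√n)^{dq n+1} = n^{−(dq n+1)/4 + 2 + O(|J|/ln n)}`).
READING (MEMO-23 §2(d)): for (CG_1') the remaining open masks are the NON-juntas (slabs/thresholds of block statistics at `|H| ≍ n`, generic thin slabs —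
MEMO-22 §3(c)); every junta mask of size `O(dq n)` is now priced with the sup over all directions inside, at every matching, with zero defect up to
size `D − 2` and a super-polynomially small one up to `≍ dq n·ln n/(8 ln 8)`.
[cite: Grigoriev2001, Lemma 1.4 (PDF p. 8)] [cite: Rothvoss2017, §2 (PDF p. 6)] [cite: Agarwal2000DifferenceEquations, Remark 1.8.1 (1.8.8)]
[cite: GriblingDelaatLaurent2019, §5]
Stature: support/instrument (kernel lane, no defs, axioms standard). WHAT THIS IS NOT: nothing on non-junta masks, no proof or refutation of
`TracialDecayExp20`, nothing on psd rank of P_PM(K_n), no P-vs-NP content. Supports stmt-PneNP-19878.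
-/

set_option linter.dupNamespace false -- `Summit.PneNP.PneNP.…`: summit = sub-problem (D-0017)

noncomputable section

namespace Summit.PneNP.PneNP.Theorems.ChebyshevTracialDesignJuntaContainmentAllDirections

open Finset Matrix Polynomial Literature.Barriers.PneNP Literature.Combinatorics.Optimization
open Literature.Combinatorics.Optimization.ShellStep (shell)
open Summit.PneNP.PneNP.Theorems.ChebyshevTracialDesignJunta (card_eq_cr_add_two_mul_in two_mul_card_pmatch sum_oddSet_level_eq)
open Summit.PneNP.PneNP.Theorems.ChebyshevTracialDesignJuntaTiltedProfile (tiltedJunta_levelLaw)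
open Summit.PneNP.PneNP.Theorems.ChebyshevTracialDesignJuntaRemainderRung (pow_div_descFactorial_le)
open Summit.PneNP.PneNP.Theorems.ChebyshevTracialDesignShellOperatorForm (designValue_eq_shellAvg card_shell_partner sum_oddSet_shell
  shell_partner_nonempty)

variable {n : ℕ}

/-! ### §1 From the level law to the design value at a matching -/

/-- Shell sums versus the crossing/internal count filter of the junta files: for `c + 2i = t` (`t` odd) and any `G`,
`Σ_{U ∈ Shell_c(M)} G(U) = Σ_{U : cr(U) = c, in(U) = i} G(U)`. [cite: Rothvoss2017, §2 (PDF p. 6)] -/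
theorem sum_shell_eq_sum_crIn (M : PMatch n) {t c i : ℕ} (ht : Odd t) (hci : c + 2 * i = t) (G : Finset (Fin n) → ℝ) :
    ∑ U' ∈ shell M.2.partner t c, G U' =
      ∑ U' ∈ (univ : Finset (Fin n)).powerset.filter (fun U' =>
          (M.1.filter fun e => cutCount U' e = 1).card = c ∧ (M.1.filter fun e => cutCount U' e = 2).card = i), G U' := by
  classical
  rw [← sum_oddSet_shell M ht G]
  have key := sum_oddSet_level_eq M hci (r := 1) (fun U => G U.1 • (1 : Matrix (Fin 1) (Fin 1) ℝ)) (fun _ => 1)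
  simp only [Matrix.trace_smul, Matrix.trace_one, Fintype.card_fin, Nat.cast_one, smul_eq_mul, mul_one] at key
  rw [key]
  refine sum_congr rfl fun U' hU' => ?_
  have hodd : Odd U'.card := by
    obtain ⟨-, hc, hi⟩ := mem_filter.1 hU'
    have h := card_eq_cr_add_two_mul_in M.2 (subset_univ U')
    rw [hc, hi, hci] at h
    exact h ▸ ht
  rw [dif_pos hodd]

/-- **Design value from a level law.** For an exact design `(n,t,T,D,B_v,C,w)`, a matching `M`, and a cut statistic `G` on the odd cuts whose level sums
at `M` are `T(N;c,i)·P(c)` for a real polynomial `P` with `|P^{(D+1)}| ≤ K` on `[0, N]` (`N = n/2`):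
`Σ_U W(U,M)·G(U) ≤ |PM|⁻¹·(−P(0) + B_v·C(T,D+1)·K)`. [cite: Rothvoss2017, §2 (PDF p. 6)] [cite: Agarwal2000DifferenceEquations, Remark 1.8.1 (1.8.8)] -/
theorem designValue_le_of_levelLaw {t T D : ℕ} {Bv : ℝ} {C : Finset ℕ} {w : ℕ → ℝ} (hdes : IsExactDesign n t T D Bv C w)
    (M : PMatch n) (G : OddSet n → ℝ) (P : Polynomial ℝ)
    (hP : ∀ c i : ℕ, c + 2 * i = t →
      ∑ U' ∈ (univ : Finset (Fin n)).powerset.filter (fun U' =>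
          (M.1.filter fun e => cutCount U' e = 1).card = c ∧ (M.1.filter fun e => cutCount U' e = 2).card = i),
        (if h : Odd U'.card then G ⟨U', h⟩ else 0) = (((n / 2).choose (c + i) * (c + i).choose i * 2 ^ c : ℕ) : ℝ) * P.eval (c : ℝ))
    {K : ℝ} (hK0 : 0 ≤ K) (hK : ∀ ξ : ℝ, 0 ≤ ξ → ξ ≤ ((n / 2 : ℕ) : ℝ) → |(derivative^[D + 1] P).eval ξ| ≤ K) :
    ∑ U : OddSet n, levelWeight n t C w U M * G U ≤
      (Fintype.card (PMatch n) : ℝ)⁻¹ * (-P.eval 0 + Bv * ((T.choose (D + 1) : ℕ) : ℝ) * K) := by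
  classical
  have ht : Odd t := hdes.1
  have htn : 2 * t + 2 ≤ n := hdes.2.1
  have hTt : T ≤ t := hdes.2.2.1
  have hC := hdes.2.2.2.1
  set g : Finset (Fin n) → ℝ := fun U' => if h : Odd U'.card then G ⟨U', h⟩ else 0 with hg
  have hval := designValue_eq_shellAvg t ht C w M g
  have hGg : ∀ U : OddSet n, levelWeight n t C w U M * G U = levelWeight n t C w U M * g U.1 := fun U => by
    rw [hg]; dsimp only; rw [dif_pos U.2]
  rw [Fintype.sum_congr _ _ hGg, hval]
  -- per level `c ∈ C`: the shell average is `P(c)`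
  have havg : ∀ c ∈ C, (∑ U' ∈ shell M.2.partner t c, g U') / ((shell M.2.partner t c).card : ℝ) = P.eval (c : ℝ) := by
    intro c hc
    obtain ⟨hcodd, -, hcT, -⟩ := hC c hc
    obtain ⟨i, hci⟩ : ∃ i, c + 2 * i = t := by
      obtain ⟨a, ha⟩ := hcodd; obtain ⟨b, hb⟩ := ht; exact ⟨b - a, by omega⟩
    have hne := shell_partner_nonempty M ht hcodd (by omega) (by omega)
    have hcard : (0 : ℝ) < (shell M.2.partner t c).card := by exact_mod_cast hne.card_pos
    rw [div_eq_iff hcard.ne', sum_shell_eq_sum_crIn M ht hci g, hP c i hci, card_shell_partner M ht hci, mul_comm]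
  rw [sum_congr rfl fun c hc => by rw [havg c hc]]
  -- the Newton remainder
  have hTN : (T : ℝ) ≤ ((n / 2 : ℕ) : ℝ) := by exact_mod_cast (by omega : T ≤ n / 2)
  have h := hdes.abs_levelSum_add_le_of_hasDerivAt (fun k ξ => (derivative^[k] P).eval ξ) hK0
    (fun k _ ξ _ => by
      have hd := Polynomial.hasDerivAt (derivative^[k] P) ξ
      rwa [← Function.iterate_succ_apply' derivative k P] at hd)
    (fun ξ hξ => hK ξ hξ.1 (hξ.2.trans hTN))
  simp only [Function.iterate_zero, id_eq] at h
  have h' := (abs_le.1 h).2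
  refine mul_le_mul_of_nonneg_left ?_ (inv_nonneg.2 (Nat.cast_nonneg _))
  linarith

/-! ### §2 (CG_1') for junta masks in EVERY direction, per matching, beyond the design degree -/

/-- **JUNTA MASKS ARE PRICED IN EVERY DIRECTION, PER MATCHING.** For an exact design `(n,t,T,D,B_v,C,w)`, a perfect matching `M`, a mask
`0 ≤ f ≤ Λ_f` on the odd cuts depending only on `U ∩ J` with `2(|J|+2)+1 ≤ t`, and ANY direction `v : Fin n → ℝ` (dense, matching-adapted, any signs):
`Q^f_M(v) = Σ_U W(U,M)·f(U)·C_v(U)² ≤ |PM|⁻¹·B_v·C(T,D+1)·‖v‖₁²·Λ_f·4^{|J|+2}·C(|J|+2,D+1)·(D+1)!·N^{|J|+1−D}/[N]_{|J|+2}` (`N = n/2`). MECHANISM (brick 113a):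
the level profile of `f·C_v²` at `M` is ONE polynomial of degree `≤ |J|+2` with NONNEGATIVE virtual value (`f·C_v² = Σ_l(g_lC_v)²`, sharp half-degree
law) AND smooth (`= Σ_{p,q}v_pv_q·`pattern polynomials, termwise) — the signs of `v_pv_q` never enter a positivity argument. Zero for `|J|+2 ≤ D`
(bricks 103/109). [cite: Grigoriev2001, Lemma 1.4 (PDF p. 8)] [cite: Rothvoss2017, §2 (PDF p. 6)] [cite: Agarwal2000DifferenceEquations, Remark 1.8.1 (1.8.8)] -/
theorem containment_junta_le_allDirections {t T D : ℕ} {Bv : ℝ} {C : Finset ℕ} {w : ℕ → ℝ} (hdes : IsExactDesign n t T D Bv C w)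
    (M : PMatch n) (J : Finset (Fin n)) (hJt : 2 * (J.card + 2) + 1 ≤ t)
    (f : OddSet n → ℝ) (hf : ∀ U U' : OddSet n, U.1 ∩ J = U'.1 ∩ J → f U = f U') {Λf : ℝ} (hf0 : ∀ U, 0 ≤ f U) (hfΛ : ∀ U, f U ≤ Λf)
    (v : Fin n → ℝ) :
    ∑ U : OddSet n, levelWeight n t C w U M *
        (f U * (∑ p, v p * ((if p ∈ U.1 then (1 : ℝ) else 0) * (if M.2.partner p ∈ U.1 then (1 : ℝ) else 0))) ^ 2) ≤
      (Fintype.card (PMatch n) : ℝ)⁻¹ * (Bv * ((T.choose (D + 1) : ℕ) : ℝ) * ((∑ p, |v p|) ^ 2 * Λf * (4 : ℝ) ^ (J.card + 2) *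
        ((((J.card + 2).choose (D + 1) : ℕ) : ℝ) * ((D + 1).factorial : ℝ) * (((n / 2 : ℕ) : ℝ)) ^ (J.card + 2 - (D + 1)) /
          ((n / 2).descFactorial (J.card + 2) : ℝ)))) := by
  have ht : Odd t := hdes.1
  have htn : 2 * t + 2 ≤ n := hdes.2.1
  obtain ⟨P, -, hP0, hPval, hPsm⟩ := tiltedJunta_levelLaw M ht htn J hJt f hf hf0 hfΛ v
  have hΛf : 0 ≤ Λf := by
    have hodd1 : Odd (({(⟨0, by omega⟩ : Fin n)} : Finset (Fin n)).card) := by simp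
    exact (hf0 ⟨_, hodd1⟩).trans (hfΛ ⟨_, hodd1⟩)
  set K : ℝ := (∑ p, |v p|) ^ 2 * Λf * (4 : ℝ) ^ (J.card + 2) *
    ((((J.card + 2).choose (D + 1) : ℕ) : ℝ) * ((D + 1).factorial : ℝ) * (((n / 2 : ℕ) : ℝ)) ^ (J.card + 2 - (D + 1)) /
      ((n / 2).descFactorial (J.card + 2) : ℝ)) with hK
  have hK0 : 0 ≤ K := by rw [hK]; positivity
  have h := designValue_le_of_levelLaw hdes M
    (fun U => f U * (∑ p, v p * ((if p ∈ U.1 then (1 : ℝ) else 0) * (if M.2.partner p ∈ U.1 then (1 : ℝ) else 0))) ^ 2)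
    P (fun c i hci => by rw [← hPval c i hci]) hK0 (fun ξ h0 h1 => hPsm (D + 1) ξ h0 h1)
  refine h.trans (mul_le_mul_of_nonneg_left ?_ (inv_nonneg.2 (Nat.cast_nonneg _)))
  linarith

/-- **(CG_1') FOR JUNTA MASKS, ALL CUBE DIRECTIONS, SUMMED OVER THE MATCHINGS** (power form, `N = n/2`): for every family of matching-adapted
directions `v_M ∈ [−1,1]^n`,
`Σ_M (Q^f_M(v_M))₊ ≤ B_v·C(T,D+1)·n²·Λ_f·8^{|J|+2}·C(|J|+2,D+1)·(D+1)!/N^{D+1}` — in the balanced Chebyshev regime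
`≈ 20Λ_f n²·8^{|J|+2}(8(|J|+2)/√n)^{dq n+1}`, i.e. `n^{−(dq n+1)/4+2+O(|J|/ln n)}`: the full (CG_1') statement (sup over ALL directions per matching)
for nonnegative junta masks of size `|J| = O(dq n)`. [cite: Grigoriev2001, Lemma 1.4 (PDF p. 8)] [cite: Rothvoss2017, §2 (PDF p. 6)]
[cite: Agarwal2000DifferenceEquations, Remark 1.8.1 (1.8.8)] [cite: GriblingDelaatLaurent2019, §5] -/
theorem sum_posPart_containment_junta_allDirections {t T D : ℕ} {Bv : ℝ} {C : Finset ℕ} {w : ℕ → ℝ}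
    (hdes : IsExactDesign n t T D Bv C w) (J : Finset (Fin n)) (hJt : 2 * (J.card + 2) + 1 ≤ t)
    (f : OddSet n → ℝ) (hf : ∀ U U' : OddSet n, U.1 ∩ J = U'.1 ∩ J → f U = f U') {Λf : ℝ} (hf0 : ∀ U, 0 ≤ f U) (hfΛ : ∀ U, f U ≤ Λf)
    (v : PMatch n → Fin n → ℝ) (hv1 : ∀ M p, |v M p| ≤ 1) :
    ∑ M : PMatch n, max (∑ U : OddSet n, levelWeight n t C w U M *
        (f U * (∑ p, v M p * ((if p ∈ U.1 then (1 : ℝ) else 0) * (if M.2.partner p ∈ U.1 then (1 : ℝ) else 0))) ^ 2)) 0 ≤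
      Bv * ((T.choose (D + 1) : ℕ) : ℝ) * ((n : ℝ) ^ 2 * Λf * (8 : ℝ) ^ (J.card + 2) *
        ((((J.card + 2).choose (D + 1) : ℕ) : ℝ) * ((D + 1).factorial : ℝ) / (((n / 2 : ℕ) : ℝ)) ^ (D + 1))) := by
  have ht : Odd t := hdes.1
  have htn : 2 * t + 2 ≤ n := hdes.2.1
  have hB : 0 ≤ Bv := (sum_nonneg fun c _ => abs_nonneg (w c)).trans hdes.2.2.2.2.2.2
  have hΛf : 0 ≤ Λf := by
    have hodd1 : Odd (({(⟨0, by omega⟩ : Fin n)} : Finset (Fin n)).card) := by simp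
    exact (hf0 ⟨_, hodd1⟩).trans (hfΛ ⟨_, hodd1⟩)
  set k := J.card + 2 with hk
  have hNpos : 0 < n / 2 := by omega
  have hkN : 2 * k ≤ n / 2 := by omega
  set X : ℝ := Bv * ((T.choose (D + 1) : ℕ) : ℝ) * ((n : ℝ) ^ 2 * Λf * (8 : ℝ) ^ k *
    (((k.choose (D + 1) : ℕ) : ℝ) * ((D + 1).factorial : ℝ) / (((n / 2 : ℕ) : ℝ)) ^ (D + 1))) with hX
  have hX0 : 0 ≤ X := by rw [hX]; positivity
  -- the per-matching constant is at most `X`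
  have hKX : ∀ M : PMatch n, Bv * ((T.choose (D + 1) : ℕ) : ℝ) * ((∑ p, |v M p|) ^ 2 * Λf * (4 : ℝ) ^ k *
      (((k.choose (D + 1) : ℕ) : ℝ) * ((D + 1).factorial : ℝ) * (((n / 2 : ℕ) : ℝ)) ^ (k - (D + 1)) / ((n / 2).descFactorial k : ℝ))) ≤ X := by
    intro M
    rw [hX]
    refine mul_le_mul_of_nonneg_left ?_ (by positivity)
    have hv2 : (∑ p, |v M p|) ^ 2 ≤ (n : ℝ) ^ 2 := by
      have h1 : ∑ p, |v M p| ≤ n := by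
        calc ∑ p, |v M p| ≤ ∑ _p : Fin n, (1 : ℝ) := sum_le_sum fun p _ => hv1 M p
          _ = n := by simp
      exact pow_le_pow_left₀ (sum_nonneg fun p _ => abs_nonneg _) h1 2
    rcases le_or_gt (D + 1) k with hle | hlt
    · have key := pow_div_descFactorial_le hNpos hkN hle
      have h8 : (4 : ℝ) ^ k * (2 : ℝ) ^ k = (8 : ℝ) ^ k := by rw [← mul_pow]; norm_num
      calc (∑ p, |v M p|) ^ 2 * Λf * (4 : ℝ) ^ k *
            (((k.choose (D + 1) : ℕ) : ℝ) * ((D + 1).factorial : ℝ) * (((n / 2 : ℕ) : ℝ)) ^ (k - (D + 1)) / ((n / 2).descFactorial k : ℝ))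
          = (∑ p, |v M p|) ^ 2 * Λf * (4 : ℝ) ^ k * (((k.choose (D + 1) : ℕ) : ℝ) * ((D + 1).factorial : ℝ)) *
              ((((n / 2 : ℕ) : ℝ)) ^ (k - (D + 1)) / ((n / 2).descFactorial k : ℝ)) := by ring
        _ ≤ (n : ℝ) ^ 2 * Λf * (4 : ℝ) ^ k * (((k.choose (D + 1) : ℕ) : ℝ) * ((D + 1).factorial : ℝ)) *
              ((2 : ℝ) ^ k / (((n / 2 : ℕ) : ℝ)) ^ (D + 1)) := by
            refine mul_le_mul ?_ key (by positivity) (by positivity)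
            exact mul_le_mul_of_nonneg_right (mul_le_mul_of_nonneg_right (mul_le_mul_of_nonneg_right hv2 hΛf) (by positivity))
              (by positivity)
        _ = (n : ℝ) ^ 2 * Λf * (8 : ℝ) ^ k * (((k.choose (D + 1) : ℕ) : ℝ) * ((D + 1).factorial : ℝ) / (((n / 2 : ℕ) : ℝ)) ^ (D + 1)) := by
            rw [← h8]; ring
    · rw [Nat.choose_eq_zero_of_lt hlt]
      simp only [Nat.cast_zero, zero_mul, zero_div, mul_zero]
      positivity
  have hper : ∀ M : PMatch n, max (∑ U : OddSet n, levelWeight n t C w U M *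
      (f U * (∑ p, v M p * ((if p ∈ U.1 then (1 : ℝ) else 0) * (if M.2.partner p ∈ U.1 then (1 : ℝ) else 0))) ^ 2)) 0 ≤
      (Fintype.card (PMatch n) : ℝ)⁻¹ * X := by
    intro M
    refine max_le ?_ (by positivity)
    exact (containment_junta_le_allDirections hdes M J hJt f hf hf0 hfΛ (v M)).trans
      (mul_le_mul_of_nonneg_left (hKX M) (inv_nonneg.2 (Nat.cast_nonneg _)))
  calc ∑ M : PMatch n, max (∑ U : OddSet n, levelWeight n t C w U M *
        (f U * (∑ p, v M p * ((if p ∈ U.1 then (1 : ℝ) else 0) * (if M.2.partner p ∈ U.1 then (1 : ℝ) else 0))) ^ 2)) 0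
      ≤ ∑ _M : PMatch n, (Fintype.card (PMatch n) : ℝ)⁻¹ * X := sum_le_sum fun M _ => hper M
    _ ≤ X := by
        rw [sum_const, card_univ, nsmul_eq_mul]
        rcases eq_or_ne (Fintype.card (PMatch n) : ℝ) 0 with h0 | h0
        · rw [h0]; simp [hX0]
        · rw [← mul_assoc, mul_inv_cancel₀ h0, one_mul]

/-- **The balanced Chebyshev instance.** For every balanced exact design of degree `dq n` on levels `≤ Tq n` (variation `≤ B_v`), every `J` with
`2(|J|+2)+1 ≤ n/4`, every nonnegative `J`-junta mask `f ≤ Λ_f` and every family of cube directions `v_M`: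
`Σ_M (Q^f_M(v_M))₊ ≤ B_v·C(Tq n, dq n+1)·n²Λ_f·8^{|J|+2}·C(|J|+2, dq n+1)(dq n+1)!/(n/2)^{dq n+1}`. [cite: Grigoriev2001, Lemma 1.4 (PDF p. 8)]
[cite: Rothvoss2017, §2 (PDF p. 6)] [cite: GriblingDelaatLaurent2019, §5] -/
theorem sum_posPart_containment_junta_allDirections_bal {t : ℕ} {Bv : ℝ} {C : Finset ℕ} {w : ℕ → ℝ}
    (hdes : IsBalancedDesign n t (Tq n) (dq n) Bv C w) (J : Finset (Fin n)) (hJn : 4 * (2 * (J.card + 2) + 1) ≤ n)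
    (f : OddSet n → ℝ) (hf : ∀ U U' : OddSet n, U.1 ∩ J = U'.1 ∩ J → f U = f U') {Λf : ℝ} (hf0 : ∀ U, 0 ≤ f U) (hfΛ : ∀ U, f U ≤ Λf)
    (v : PMatch n → Fin n → ℝ) (hv1 : ∀ M p, |v M p| ≤ 1) :
    ∑ M : PMatch n, max (∑ U : OddSet n, levelWeight n t C w U M *
        (f U * (∑ p, v M p * ((if p ∈ U.1 then (1 : ℝ) else 0) * (if M.2.partner p ∈ U.1 then (1 : ℝ) else 0))) ^ 2)) 0 ≤
      Bv * (((Tq n).choose (dq n + 1) : ℕ) : ℝ) * ((n : ℝ) ^ 2 * Λf * (8 : ℝ) ^ (J.card + 2) *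
        ((((J.card + 2).choose (dq n + 1) : ℕ) : ℝ) * ((dq n + 1).factorial : ℝ) / (((n / 2 : ℕ) : ℝ)) ^ (dq n + 1))) := by
  have hbal : n ≤ 4 * t := hdes.2
  exact sum_posPart_containment_junta_allDirections hdes.1 J (by omega) f hf hf0 hfΛ v hv1

end Summit.PneNP.PneNP.Theorems.ChebyshevTracialDesignJuntaContainmentAllDirections
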